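import Summits.Ventures.HSemireg.WedgeHankelSubstitutionCatalecticant
import Summits.Ventures.HSemireg.WedgeHankelSiegelIdealStable
import Summits.Ventures.HSemireg.WedgeHankelCoSiegelClasses

/-!
# Venture HSemireg — THE GENERAL LINEAR SUBSTITUTION (5): EVERY INVERTIBLE SUBSTITUTION IS A WORD OF LENGTH ≤ 4 IN THE FIVE GENERATORS (Bruhat normal form),
# and `S_n(g)` IS THE MATRIX OF THE SUBSTITUTION ON TH-7's CLASSES in the basis `E_p = w_n(δ_p)`

HONEST FRAMING. Part of the Lean index of the computation cell `pub-hsemireg` (seat p10 gen 18, Sunday typer «UNIFORM-IN-n»).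
Finite-dimensional EXTERIOR ALGEBRA over a field ONLY: no variety, no cohomology theory, no sheaf, no Ext group, no semiregularity map;
nothing here says that HC / HC_CM / HC_AV holds; no Literature fact is declared or used.  Custodian versions as in `WedgeHankelSiegelIdeal` (1/3) and `WedgeHankelFrameChange`;
the dictionary (a change of complex frame = a word in shears / swap / scalings; `E_p = Θ^p/p!`) is QUOTED, never asserted.

WHAT IS IN THE TREE.  H1: `Sb`, `Sb_Sb` (words are matrix products), `Φs_eq_Sb` / `Ψs_eq_Sb` / `Δs_eq_Sb` / `Ls_eq_Sb` / `Xsc_eq_Sb` (the generators E5/E7/E12/F1/F5 as instances), `Sb_w`;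
H7: `sbMat` (`S_c`, the matrix of the degree-`c` moment transform), `sbSeq_eq_sum_single`; gen 11 `w_eq_sum_spikes` (`w_n(q) = Σ_p q_p E_p`); F9 `linearIndependent_w_spike`.
H1 proved «every WORD is a matrix»; THIS FILE proves the converse and identifies `S_n` (namespace `Summit.Ventures.HSemireg.Wedge.HankelFrameChange` continued):
* §145 **BRUHAT NORMAL FORM: `α ≠ 0`, `αδ − βγ ≠ 0` ⇒ `Sb α β γ δ = Φs (β/α) ∘ Δs ((αδ−βγ)/α) ∘ Ls γ ∘ Xsc α`** (`Sb_eq_word_of_ne`: x-scaling, lower shear, y-scaling, upper shear), and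
  **`α = 0` (`β ≠ 0 ≠ γ`) ⇒ `Sb 0 β γ δ = Ψs ∘ Δs γ ∘ Ls δ ∘ Xsc β`** (`Sb_eq_word_of_eq`) — EVERY invertible substitution is a word of length ≤ 4 in the five generators of gens 15–16, so
  every statement the lineage proved generator by generator (E5/E7/E12/F1/F5) holds for all of `GL₂` and conversely; the lower-triangular factor alone: `Sb_lower_eq_word`.
* §146 **`Sb_w_spike_eq_sum`: `Sb α β γ δ (E_p) = Σ_{a ≤ n} (S_n)_{a,p} · E_a`** (`E_p = w_n(δ_p)`; `S_n = sbMat n (n+1)`) and **`Sb_w_eq_sum_sbMat`: `Sb (w_n q) = Σ_a (Σ_p (S_n)_{a,p} q_p) · E_a`** —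
  THE MATRIX OF THE SUBSTITUTION ON TH-7's CLASSES (the co-Siegel `n`-forms, F9) IN THE BASIS `E_0, …, E_n` IS `S_n(g)`, the top symmetric power of the moment transform.
NOT typed here: `S_c(g·g′) = S_c(g′)·S_c(g)` as a matrix identity (it is `sbSeq_comp_apply`, H1b, entrywise); `det S_c`; anything Ext-side.  Class side only; new names only.
-/

open Module

namespace Summit.Ventures.HSemireg.Wedge.HankelFrameChange

open Summit.Ventures.HSemireg.Wedge Summit.Ventures.HSemireg.Wedge.Kunneth Summit.Ventures.HSemireg.Wedge.Hankel
  Summit.Ventures.HSemireg.Wedge.BasisFree Summit.Ventures.HSemireg.Wedge.HankelSiegel Summit.Ventures.HSemireg.Wedge.HankelSiegelIdeal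
  Summit.Ventures.HSemireg.Wedge.KunnethKernel Summit.Ventures.HSemireg.Wedge.HankelRankOne

variable (K : Type*) [Field K] {n : ℕ}

/-! ## §145. Bruhat normal form: every invertible substitution is a word in the generators -/

/-- **the lower-triangular factor is a word of length 3: `Sb α 0 γ d = Δs d ∘ Ls γ ∘ Xsc α`** (`α ≠ 0 ≠ d`: x-scaling, then lower shear, then y-scaling). -/
theorem Sb_lower_eq_word {α d : K} (hα : α ≠ 0) (hd : d ≠ 0) (γ : K) (f : HT K (In n)) :
    Sb K α 0 γ d f = Δs K hd (Ls K γ (Xsc K hα f)) := by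
  rw [← AlgEquiv.coe_toAlgHom (Xsc K hα), ← AlgEquiv.coe_toAlgHom (Ls K γ), ← AlgEquiv.coe_toAlgHom (Δs K hd), Xsc_eq_Sb, Ls_eq_Sb, Δs_eq_Sb, Sb_Sb, Sb_Sb]
  simp only [one_mul, mul_one, zero_mul, mul_zero, add_zero, zero_add]

/-- **BRUHAT NORMAL FORM, `α ≠ 0`: `Sb α β γ δ = Φs (β/α) ∘ Δs ((αδ−βγ)/α) ∘ Ls γ ∘ Xsc α`** (`αδ − βγ ≠ 0`) — every invertible substitution with `α ≠ 0` is a word of length `4` in the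
generators: x-scaling, lower shear, y-scaling, upper shear (the `LU` factorization of H2 with `L` spelled out). -/
theorem Sb_eq_word_of_ne {α β γ δ : K} (hα : α ≠ 0) (hdet : α * δ - β * γ ≠ 0) (f : HT K (In n)) :
    Sb K α β γ δ f = Φs K (β / α) (Δs K (div_ne_zero hdet hα) (Ls K γ (Xsc K hα f))) := by
  rw [← Sb_lower_eq_word, ← AlgEquiv.coe_toAlgHom (Φs K (β / α)), Φs_eq_Sb, Sb_Sb]
  have e1 : α * 1 + 0 * 0 = α := by ring
  have e2 : α * (β / α) + 0 * 1 = β := by rw [zero_mul, add_zero, mul_div_cancel₀ β hα]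
  have e3 : γ * 1 + (α * δ - β * γ) / α * 0 = γ := by ring
  have e4 : γ * (β / α) + (α * δ - β * γ) / α * 1 = δ := by field_simp; ring
  rw [e1, e2, e3, e4]

/-- **BRUHAT NORMAL FORM, `α = 0`: `Sb 0 β γ δ = Ψs ∘ Δs γ ∘ Ls δ ∘ Xsc β`** (`β ≠ 0 ≠ γ`) — the swap after a lower-triangular word. -/
theorem Sb_eq_word_of_eq {β γ : K} (hβ : β ≠ 0) (hγ : γ ≠ 0) (δ : K) (f : HT K (In n)) :
    Sb K 0 β γ δ f = Ψs K (Δs K hγ (Ls K δ (Xsc K hβ f))) := by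
  rw [← Sb_lower_eq_word, ← AlgEquiv.coe_toAlgHom (Ψs K), Ψs_eq_Sb, Sb_Sb]
  simp only [mul_one, mul_zero, add_zero, zero_add]

/-- so **every invertible substitution is a composite of the lineage's generator automorphisms** (existence form, both cases). -/
theorem exists_word_eq_Sb {α β γ δ : K} (hdet : α * δ - β * γ ≠ 0) :
    (∃ (lam d c mu : K) (hd : d ≠ 0) (hmu : mu ≠ 0), ∀ f : HT K (In n), Sb K α β γ δ f = Φs K lam (Δs K hmu (Ls K c (Xsc K hd f)))) ∨
    (∃ (d c mu : K) (hd : d ≠ 0) (hmu : mu ≠ 0), ∀ f : HT K (In n), Sb K α β γ δ f = Ψs K (Δs K hmu (Ls K c (Xsc K hd f)))) := by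
  by_cases hα : α = 0
  · subst hα
    have hβ : β ≠ 0 := by rintro rfl; apply hdet; ring
    have hγ : γ ≠ 0 := by rintro rfl; apply hdet; ring
    exact Or.inr ⟨β, δ, γ, hβ, hγ, fun f => Sb_eq_word_of_eq K hβ hγ δ f⟩
  · exact Or.inl ⟨β / α, α, γ, (α * δ - β * γ) / α, hα, div_ne_zero hdet hα, fun f => Sb_eq_word_of_ne K hα hdet f⟩

/-! ## §146. The matrix of the substitution on th-7's classes is `S_n` -/

/-- **`Sb α β γ δ (E_p) = Σ_{a ≤ n} (S_n)_{a,p} · E_a`** for the spike classes `E_p = w_n(δ_p)`, `p ≤ n` (`S_n = sbMat n (n+1)`): the `p`-th column of `S_n` holds the coordinates of the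
transformed `p`-th basis class. -/
theorem Sb_w_spike_eq_sum (α β γ δ : K) (p : Fin (n + 1)) :
    Sb K α β γ δ (w K n n (fun i => if i = (p : ℕ) then (1 : K) else 0)) =
      ∑ a : Fin (n + 1), sbMat K α β γ δ n (n + 1) a p • w K n n (fun i => if i = (a : ℕ) then (1 : K) else 0) := by
  rw [Sb_w K α β γ δ le_rfl, w_eq_sum_spikes, ← Fin.sum_univ_eq_sum_range (fun a => sbSeq K α β γ δ n (fun i => if i = (p : ℕ) then (1 : K) else 0) a •
      w K n n (fun i => if i = a then (1 : K) else 0))]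
  rfl

/-- **`Sb α β γ δ (w_n(q)) = Σ_a (Σ_p (S_n)_{a,p} q_p) · E_a`** — in the basis `E_0, …, E_n` of th-7's classes the substitution acts by the matrix `S_n(g)` on the coefficient window
(H7's `sbSeq_eq_sbMat_sum` inside gen 11's spike expansion). -/
theorem Sb_w_eq_sum_sbMat (α β γ δ : K) (q : ℕ → K) :
    Sb K α β γ δ (w K n n q) = ∑ a : Fin (n + 1), (∑ p : Fin (n + 1), sbMat K α β γ δ n (n + 1) a p * q p) • w K n n (fun i => if i = (a : ℕ) then (1 : K) else 0) := by
  rw [Sb_w K α β γ δ le_rfl, w_eq_sum_spikes, ← Fin.sum_univ_eq_sum_range (fun a => sbSeq K α β γ δ n q a • w K n n (fun i => if i = a then (1 : K) else 0))]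
  exact Finset.sum_congr rfl fun a _ => by rw [sbSeq_eq_sbMat_sum]

/-- the coordinates are unique (F9's independence): if `Sb (w_n q) = Σ_a c_a · E_a` then `c_a = Σ_p (S_n)_{a,p} q_p` — `S_n(g)` IS the matrix of `Sb g` on the classes. -/
theorem eq_sbMat_mulVec_of_Sb_w_eq (α β γ δ : K) (q : ℕ → K) (c : Fin (n + 1) → K)
    (h : Sb K α β γ δ (w K n n q) = ∑ a : Fin (n + 1), c a • w K n n (fun i => if i = (a : ℕ) then (1 : K) else 0)) (a : Fin (n + 1)) :
    c a = ∑ p : Fin (n + 1), sbMat K α β γ δ n (n + 1) a p * q p := by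
  rw [Sb_w_eq_sum_sbMat] at h
  have hs : ∑ b : Fin (n + 1), (c b - ∑ p : Fin (n + 1), sbMat K α β γ δ n (n + 1) b p * q p) • w K n n (fun i => if i = (b : ℕ) then (1 : K) else 0) = 0 := by
    simp only [sub_smul, Finset.sum_sub_distrib, h, sub_self]
  have h0 := linearIndependent_iff'.mp (KernelDuality.linearIndependent_w_spike K (n := n)) Finset.univ _ hs a (Finset.mem_univ _)
  exact (sub_eq_zero.mp h0)

end Summit.Ventures.HSemireg.Wedge.HankelFrameChange
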